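import Summits.QuantumFields.YangMills.Theorems.UnitScaleGibbsBlockPlaquetteLinearisationOnBoxEvent
import Summits.QuantumFields.YangMills.Theorems.UnitScaleGibbsNormalEquationNetFluxLinWeight
import HarnessLib

/-!
# `UnitScaleGibbsBlockPlaquetteLinWeightSupport` — THE SPATIAL SUPPORT OF THE NESTED OFFSET-MEAN WEIGHT: `linWeight j a p ≠ 0` ONLY FOR FINE PLAQUETTES
# `p = ⟨walkEnd (c 0) v, a.μ, a.ν⟩` REACHED FROM THE CONE'S BASE BY A WALK OF LENGTH `≤ ((d+4)L+2)·Σ_{k<j} L^k` (KNIT-A2 of the `stub_linTest` v3.1 plan;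
# LINE 28 «GrossTransfer», crux `UnitScaleTilt.HistoryTailL` stmt-QuantumFields-19936 ∕ `MeanDeviationL` stmt-QuantumFields-23083)

Cell `ym3-torus` (YM ladder rung R3 = continuum SU(2) Yang–Mills on T³ — a RUNG, NOT the Clay problem: not d = 4, not infinite volume, not a mass gap),
width seat `ym-ust-19936-w2` (gen 15), pen of record of `stub_linTest`.  The KNIT (KNIT-PLAN, 23083 evidence #9) transports the block-plaquette proxy
`Σ_p linWeight j a p • (V(∂p) − 1)` to `ℤ³`; for that the torus sum must run over the chart image of a box only.  The recursion ✓`linWeight_succ`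
(✓`UnitScaleGibbsBlockPlaquetteLinWeightDefs`) moves, per level, from `emb a.src` along a stair word `stairWord σ (off r)` and two straight runs `t, s < L`
— total length `≤ (d+4)L` (✓`length_stairWord_le`, as in ✓`UnitScaleGibbsBlockPlaquetteSmallFieldCone.dist1_transporter_le_of_bondSmall`) — and crossing a
level dilates walks by `L` (✓`walkEnd_emb_walkEnd_eq`).  WHAT IS PROVED: ★★`exists_walk_of_linWeight_ne_zero` — for a cone `c` (`c j = a.src`,
`c i = emb (c (i+1))`), `linWeight j a p ≠ 0 → p.μ = a.μ ∧ p.ν = a.ν ∧ ∃ v, |v| ≤ ((d+4)L+2)·Σ_{k<j}L^k ∧ p.src = walkEnd (c 0) v`; ★`linWeight_eq_zero_of_far`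
(contrapositive in `castSite` coordinates: with `c 0 = castSite z₀`, `linWeight j a p = 0` unless `p.src = castSite y` with `|y − z₀|_∞ ≤ R₀`).
HONEST FRAMING.  Combinatorics of the (0.4) stencil; `--supports` helper; proves no stub, crux, rung or summit statement; `stub_linTest`, «ShallowFluxSecondMomentL»,
(Q), K1, `MeanDeviationL`, `HistoryTailL` are NOT proved; the Yang–Mills mass gap is NOT proved.
References: [Balaban1985Averaging] (47)–(48) pp. 25–26; [Balaban1987RG1] (0.1)–(0.4) pp. 251–253.
-/

noncomputable section

open scoped BigOperators
open Literature.MathematicalPhysics.QuantumFieldTheory.Balaban1983to89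
open T4Continuum T4ReflectionCone BlockAveraging B10Eq47AxialChi LatticeWordStokes
open Literature.MathematicalPhysics.QuantumFieldTheory.Balaban1983to89.T4AxialGaugeSmallField (castSite)
open Summit.QuantumFields.YangMills.BalabanUVNodes.N20LCSAvgDomination (shiftN_eq_walkEnd_replicate)
open Summit.QuantumFields.YangMills.Theorems.UnitScaleGibbsBlockPlaquetteLinWeight (linWeight linWeight_succ linWeight_zero_of_ne linWeight_nonneg)
open Summit.QuantumFields.YangMills.Theorems.UnitScaleGibbsBlockPlaquetteSmallFieldCone (walkEnd_emb_walkEnd_eq)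
open Summit.QuantumFields.YangMills.Theorems.UnitScaleGibbsBlockPlaquetteLinearisationOnBoxEvent (exists_cone)
open Summit.QuantumFields.YangMills.Theorems.UnitScaleGibbsBlockPlaquetteSmallFieldBoxBridge (walkEnd_castSite endpoint_mem_box)

namespace Summit.QuantumFields.YangMills.Theorems.UnitScaleGibbsBlockPlaquetteLinWeightSupport

variable {P : Params}

/-- The per-level stencil: the level-`j` plaquette corner `shiftN (shiftN (walkEnd (emb y) (stairWord σ (off r))) ν t) μ s` (`t, s < L`) is `walkEnd (emb y) w`
for a walk `w` of length `≤ (d+4)·L`. [cite: Balaban1985Averaging, (47)-(48) pp.25-26] -/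
theorem exists_walk_stencil {j : ℕ} (y : Site P (j + 1)) (σ : Equiv.Perm (Fin P.d)) (r : Fin P.d → Fin P.L) (μ ν : Fin P.d)
    {t s : ℕ} (ht : t < P.L) (hs : s < P.L) :
    ∃ w : List (Letter P.d), w.length ≤ (P.d + 4) * P.L ∧
      shiftN (shiftN (walkEnd (emb y) (stairWord σ (off r))) ν t) μ s = walkEnd (emb y) w := by
  have hn : ∀ κ, (off r κ).natAbs ≤ (P.L - 1) / 2 := fun κ => by
    have h := off_bounds r κ
    omega
  have hlen := length_stairWord_le σ (off r) _ hn
  have hdL : P.d * ((P.L - 1) / 2) ≤ P.d * P.L := Nat.mul_le_mul_left _ (by omega)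
  refine ⟨stairWord σ (off r) ++ List.replicate t (ν, true) ++ List.replicate s (μ, true), ?_, ?_⟩
  · rw [List.length_append, List.length_append, List.length_replicate, List.length_replicate]
    have e : (P.d + 4) * P.L = P.d * P.L + 4 * P.L := by ring
    omega
  · rw [shiftN_eq_walkEnd_replicate, shiftN_eq_walkEnd_replicate, ← walkEnd_append, ← walkEnd_append, List.append_assoc]

/-- **CONES UNDER WALK-RELATED TOPS ARE WALK-RELATED AT THE BASE, WITH DILATION `L^j`**: if `c`, `c''` are cones down from level `j`
(`c i = emb (c (i+1))`, `c'' i = emb (c'' (i+1))` for `i < j`) and `c'' j = walkEnd (c j) w`, then `c'' 0 = walkEnd (c 0) u` with `|u| ≤ L^j·|w|`.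
[cite: Balaban1987RG1, (0.1)-(0.3) pp.251-252] -/
theorem exists_walk_cone_base : ∀ (j : ℕ) (c c'' : (i : ℕ) → Site P i) (w : List (Letter P.d)),
    (∀ i, i < j → c i = emb (c (i + 1))) → (∀ i, i < j → c'' i = emb (c'' (i + 1))) → c'' j = walkEnd (c j) w →
      ∃ u : List (Letter P.d), u.length ≤ P.L ^ j * w.length ∧ c'' 0 = walkEnd (c 0) u
  | 0, c, c'', w, _, _, htop => ⟨w, by simp, htop⟩
  | j + 1, c, c'', w, hc, hc'', htop => by
    -- one level down: `c'' j = emb (c'' (j+1)) = emb (walkEnd (c (j+1)) w) = walkEnd (c j) u₁`, `|u₁| ≤ L·|w|`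
    obtain ⟨u₁, hu₁, hu₁eq⟩ := walkEnd_emb_walkEnd_eq (hc j (Nat.lt_succ_self j)) (R := P.L * w.length + 0) (R' := w.length) (R₀ := 0)
      le_rfl w le_rfl [] (by simp)
    have htop' : c'' j = walkEnd (c j) u₁ := by
      rw [hc'' j (Nat.lt_succ_self j), htop, ← hu₁eq]; rfl
    obtain ⟨u, hu, hueq⟩ := exists_walk_cone_base j c c'' u₁ (fun i hi => hc i (Nat.lt_succ_of_lt hi)) (fun i hi => hc'' i (Nat.lt_succ_of_lt hi)) htop'
    refine ⟨u, hu.trans ?_, hueq⟩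
    calc P.L ^ j * u₁.length ≤ P.L ^ j * (P.L * w.length) := Nat.mul_le_mul_left _ (by simpa using hu₁)
      _ = P.L ^ (j + 1) * w.length := by ring

/-- ★★ **THE SPATIAL SUPPORT OF `linWeight`.**  Let `c` be a cone over `a` (`c j = a.src`, `c i = emb (c (i+1))` for `i < j`).  If `linWeight j a p ≠ 0` then
`p` has `a`'s orientation and `p.src = walkEnd (c 0) v` for a fine walk of length `≤ ((d+4)L+2)·Σ_{k<j} L^k`. [cite: Balaban1985Averaging, (47)-(48) pp.25-26] -/
theorem exists_walk_of_linWeight_ne_zero : ∀ (j : ℕ) (a : Plaq P j) (c : (i : ℕ) → Site P i), c j = a.src → (∀ i, i < j → c i = emb (c (i + 1))) →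
    ∀ p : Plaq P 0, linWeight j a p ≠ 0 →
      p.μ = a.μ ∧ p.ν = a.ν ∧ ∃ v : List (Letter P.d), v.length ≤ ((P.d + 4) * P.L + 2) * ∑ k ∈ Finset.range j, P.L ^ k ∧ p.src = walkEnd (c 0) v
  | 0, a, c, hcj, _, p, hp => by
    by_cases h : a = p
    · subst h
      exact ⟨rfl, rfl, [], by simp, by rw [hcj]; rfl⟩
    · exact absurd (linWeight_zero_of_ne h) hp
  | j + 1, a, c, hcj, hc, p, hp => by
    classical
    rw [linWeight_succ] at hp
    have hsum := (mul_ne_zero_iff.mp hp).2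
    obtain ⟨J, -, hJ⟩ := Finset.exists_ne_zero_of_sum_ne_zero hsum
    obtain ⟨t, ht, hJt⟩ := Finset.exists_ne_zero_of_sum_ne_zero hJ
    obtain ⟨s, hs, hJts⟩ := Finset.exists_ne_zero_of_sum_ne_zero hJt
    rw [Finset.mem_range] at ht hs
    -- the level-`j` plaquette of the stencil, as a walk from `emb a.src = c j`
    obtain ⟨w, hwlen, hw⟩ := exists_walk_stencil a.src J.2.1 J.1 a.μ a.ν ht hs
    have hcj' : c j = emb a.src := by rw [hc j (Nat.lt_succ_self j), hcj]
    -- a cone below the stencil plaquette and the induction hypothesis there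
    obtain ⟨c'', hc''j, hc''⟩ := exists_cone (P := P) j
      (shiftN (shiftN (walkEnd (emb a.src) (stairWord J.2.1 (off J.1))) a.ν t) a.μ s)
    obtain ⟨hμ, hν, v, hvlen, hv⟩ := exists_walk_of_linWeight_ne_zero j _ c'' hc''j hc'' p hJts
    -- transfer the base of `c''` to the base of `c`
    have htop : c'' j = walkEnd (c j) w := by rw [hc''j, hw, hcj']
    obtain ⟨u, hulen, hu⟩ := exists_walk_cone_base j c c'' w (fun i hi => hc i (Nat.lt_succ_of_lt hi)) hc'' htop
    refine ⟨hμ, hν, u ++ v, ?_, ?_⟩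
    · rw [List.length_append, Finset.sum_range_succ, Nat.mul_add]
      have h1 : u.length ≤ ((P.d + 4) * P.L + 2) * P.L ^ j := by
        calc u.length ≤ P.L ^ j * w.length := hulen
          _ ≤ P.L ^ j * ((P.d + 4) * P.L) := Nat.mul_le_mul_left _ hwlen
          _ ≤ ((P.d + 4) * P.L + 2) * P.L ^ j := by rw [Nat.mul_comm]; exact Nat.mul_le_mul_right _ (by omega)
      omega
    · rw [hv, hu, walkEnd_append]

/-- `|netDisp v ν| ≤ |v|` (= ✓`HistoryTailWalkLocality.abs_netDisp_le_length`; re-derived, as in ✓`…SmallFieldBoxBridge`, to keep this file off the route cone). [folklore] -/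
private theorem abs_netDisp_le_length' {d : ℕ} (ν : Fin d) : ∀ v : List (Letter d), |netDisp v ν| ≤ v.length
  | [] => by simp [netDisp]
  | l :: v => by
    rw [netDisp_cons, List.length_cons]
    have ih := abs_netDisp_le_length' ν v
    have hl : |(if l.1 = ν then (if l.2 then (1 : ℤ) else -1) else 0)| ≤ 1 := by
      split_ifs <;> simp
    push_cast
    exact (abs_add_le _ _).trans (by linarith)

/-- ★ **IN `castSite` COORDINATES**: with `c 0 = castSite z₀`, `linWeight j a p ≠ 0` forces `p.src = castSite y` for an integer point `y` with
`|y κ − z₀ κ| ≤ ((d+4)L+2)·Σ_{k<j} L^k` in every coordinate (and `p`'s orientation is `a`'s). [cite: Balaban1985Averaging, (47)-(48) pp.25-26] -/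
theorem exists_castSite_of_linWeight_ne_zero (j : ℕ) (a : Plaq P j) (c : (i : ℕ) → Site P i) (hcj : c j = a.src)
    (hc : ∀ i, i < j → c i = emb (c (i + 1))) (z₀ : Fin P.d → ℤ) (hz : c 0 = castSite z₀) (p : Plaq P 0) (hp : linWeight j a p ≠ 0) :
    p.μ = a.μ ∧ p.ν = a.ν ∧ ∃ y : Fin P.d → ℤ, (∀ κ, |y κ - z₀ κ| ≤ (((P.d + 4) * P.L + 2) * ∑ k ∈ Finset.range j, P.L ^ k : ℕ)) ∧ p.src = castSite y := by
  obtain ⟨hμ, hν, v, hvlen, hv⟩ := exists_walk_of_linWeight_ne_zero j a c hcj hc p hp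
  refine ⟨hμ, hν, fun κ => z₀ κ + netDisp v κ, fun κ => ?_, by rw [hv, hz, walkEnd_castSite]⟩
  rw [add_sub_cancel_left]
  exact (abs_netDisp_le_length' κ v).trans (by exact_mod_cast hvlen)

end Summit.QuantumFields.YangMills.Theorems.UnitScaleGibbsBlockPlaquetteLinWeightSupport

end
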